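import Literature.MathematicalPhysics.QuantumFieldTheory.Balaban1983to89.B9Thm31GradGpAtKnitLetterOfCubeData
import Literature.MathematicalPhysics.QuantumFieldTheory.Balaban1983to89.B8Thm2TorusCoverOfEBlockSymG

/-!
# [B7] «α₀ sufficiently small» for the bond-sector junction: the three junction windows from three located smallness conditions ((T) FILE 5-quater, part 1)

T. Bałaban, *Averaging operations for lattice gauge theories*, Commun. Math. Phys. **98** (1985) 17–51 [`Balaban1985Averaging`, "[B7]"]; *Propagators for lattice
gauge theories in a background field*, Commun. Math. Phys. **99** (1985) 389–434 [`Balaban1985BackgroundPropagators`, "[B9]"]; *Propagators and renormalization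
transformations for lattice gauge theories. II*, Commun. Math. Phys. **96** (1984) 223–250 [`Balaban1984PropagatorsII`, "[4]"].  statement-level skeleton of published
theorems with citation tags; proofs where landed; nothing here is a claim about the Yang–Mills mass gap

THE PRINT.  [B7] Prop. 2 p. 26 («α₀ sufficiently small»), (52)–(53) pp. 26–27; [B9] Thm 3.9 p. 413, (3.90) pp. 409–410 («expansions … convergent»), (3.106) p. 414;
[4] (2.66)–(2.67) p. 234 (the Neumann-series smallness `θc₁ < 1`).

WHY THIS FILE (cell `lit-balaban`; seat t2s-1 gen 10).  The torus Thm 2 cover interface of record (t2s-1 5-ter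
`B8Thm2TorusCoverOfEBlockSymG.hThm2Cover_of_prop6_eBlockSymG_exists`) displays three NUMERIC windows of the junction in [B7]'s class parameter `α₀′`:
J-B file 9's `θ_E·A·c₁ < 1`, file 23c's `θ_F·K_T·c₁·c₁ < 1`, and FILE 4's junction window `2·((d+3)B₀)·κ′ ≤ 1`, with the junction's named constants
`θ_E, A_K, θ_F, K_K, κ_Q, θ_Q, B_X, θ_X, B_Y, θ_Y, B₁, θ_C, κ_J` given by their defining equations (transfer constants `1`).  THIS FILE proves that all three
follow from three LOCATED smallness conditions `α₀′·Φ₁ ≤ ½`, `α₀′·Φ₂ ≤ ½`, `α₀′·Φ₃ ≤ ½` with `Φ₁, Φ₂, Φ₃ ≥ 0` EXPLICIT and INDEPENDENT of `α₀′` (polynomials in the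
def-Y's-side constants `A = A₁ = A₂`-type data, `K_T`, the (2.61) constants and FILE 4's `B₀`), hence from `α₀′ ≤ a₀ := min of 1∕(2(Φ+1))` (p33's `small_of_le`)
— [B7]'s «α₀ sufficiently small» realised explicitly for the junction (every `θ` carries one factor `α₀′`; `(1 − x)⁻¹ ≤ 2` and `x(1−x)⁻¹ ≤ 1` under `x ≤ ½`).

WHAT THIS FILE PROVES (THEOREMS; 0 `def`, 0 `def … : Prop`, 0 sorry; standard axioms).
* ★★ `junction_windows_of_small` — the three windows from the three located conditions (explicit `Φ₁, Φ₂, Φ₃`).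
* ★ `exists_junction_size` — `∃ a₀ > 0, ∀ 0 ≤ α₀′ ≤ a₀`, the three located conditions hold (`a₀ = min …`).
* §2 ★★★★★ `hThm2Cover_of_prop6_eBlockSymG_small` — 5-ter's interface of record with the junction's (2.61)-dimensions, its thirteen named constants and its three
  numeric windows INTERNALISED: `∃ d′ A₀, ∀ a′ ≥ A₀, ∀ B_E > 0, ∃ a_J > 0, ∀ a_T ⟨FILE 4 ∕ F7 windows⟩, ∀ 0 < α₀′ ≤ a_J ⟨[B7] class windows, slack a_T·L² < α₀′⟩,
  … [(1ₛ) ∧ (Eₛ) ∧ (Gₛ) ∧ (Cₛ)] → P ∣ P′ ∧ L^(K−n) ∣ P ∧ Thm2TorusAt …` (`d + 1 = 3`, `N = 2`).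
* §3 (v1.1) `rateLadder_below` (for every `δ₀ > 0` the ladder below it exists), ★★★★★ `hThm2Cover_of_prop6_eBlockSymG_final` — §2 with the rate ladder
  INTERNALISED: the displayed analytic inputs are `δ_E > 0`, `0 < α < 1`, `δ₀ > 0`, `K_G, K_T ≥ 0` and the four member statements (the FORM OF RECORD).
* §4 (v1.2) `exists_admissible_sizes` — the displayed `a_T` ∕ `α₀′` windows of the form of record are jointly inhabited for every `a_J > 0` (explicit `min`'s).

HONEST SCOPE ∕ NOT CLAIMED.  §1 is elementary real inequalities about the junction's bookkeeping constants; §2 displays (1ₛ), (Eₛ) (M5.7), (Gₛ) (M5.5), (Cₛ) (M5.6)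
per shape-member and the numeric windows in `a_T` (FILE 4 ∕ F7) and `α₀′` ([B7]'s class) — nothing here inhabits the member statements; `stub_PV3A` NOT discharged; no
summit ∕ node statement proved; nothing continuum ∕ ℝ⁴ ∕ OS — the Yang–Mills mass gap is NOT proved by any of this (Track A conditional rung).  No `sorry`, no
`axiom`, no `… : Prop` fact, no `instance`, no `notation`, no `def`; `set_option maxHeartbeats 400000 in` once (§1's main lemma: large polynomial identities).
v1.1 ∕ v1.2 (append protocol): §3, §4 added; earlier declarations byte-identical.  `--supports stmt-QuantumFields-19200` as helper.  Net new unproved facts: 0.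
REUSED BY NAME: p33 `B9Thm32CinvAtKnitLetterOfCubeData.small_of_le`, `B9Thm31GradGpAtKnitLetterOfCubeData.ratio_le_one`, `B9SectDSup.inv_one_sub_le_two`.
RELATED, NOT DUPLICATED (searched 2026-08-29: `rg 'junction_windows|exists_junction_size|SymG_small' Literature/` = ∅): 5-ter (USED BY NAME); p33 FILE 11 ∕ 13's
`a₀ := …` class sizes for the KNIT-letter transfers (the same «α₀ small» device for a different consumer).
-/

noncomputable section

namespace Literature.MathematicalPhysics.QuantumFieldTheory.Balaban1983to89.B8Thm2TorusCoverJunctionWindows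

open scoped BigOperators
open B9SectDSup (inv_one_sub_le_two)
open B9Thm32CinvAtKnitLetterOfCubeData (small_of_le)
open B9Thm31GradGpAtKnitLetterOfCubeData (ratio_le_one)

set_option maxHeartbeats 400000 in
/-- ★★ **THE THREE JUNCTION WINDOWS FROM THREE LOCATED SMALLNESS CONDITIONS.**  With `θ_E = 32(d+1)²α₀′S` (`S = M₂Σ‖b_j‖`), `A_K = Ac_g(1 − θ_EAc_g)⁻¹`, 23b's `θ_F`,
`K_K = K_Tc₄(1 − θ_FK_Tc₃c₄)⁻¹`, `κ_Q = S`, `θ_Q = 16(d+1)²α₀′S`, `B_X = A₁(1 + c_gθ_EAc_g(1 − θ_EAc_g)⁻¹)`, `θ_X = B_Xθ_EAc_b`, `B_Y = (d+1)A₂`, `θ_Y = A_Kθ_EB_Yc_b`,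
`B₁ = max K_T K_K`, `θ_C = B₁²θ_Fc₅²`, `κ_J = c_B²(…)` (transfer constants `1`): IF `α₀′Φ₁ ≤ ½` (`Φ₁ = 32(d+1)²SAc_g`), `α₀′Φ₂ ≤ ½` (`Φ₂ = Φ_FK_Tc₃c₄`, `Φ_F` = `θ_F∕α₀′`
with `A_K ↦ 2Ac_g`) and `α₀′Φ₃ ≤ ½` (`Φ₃ = 2(d+3)B₀·Φ_J·S·c_W`, `Φ_J` = `κ_J∕α₀′` with `A_K ↦ 2Ac_g`, `B_X ↦ A₁(1+c_g)`, `B₁ ↦ max K_T 2K_Tc₄`), THEN `θ_EAc_g < 1`,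
`θ_FK_Tc₃c₄ < 1` and `2((d+3)B₀)(κ_J·S·c_W) ≤ 1`. [cite: Balaban1985Averaging, Prop. 2 p.26 («α₀ sufficiently small»); Balaban1984PropagatorsII, (2.66)–(2.67) p.234; Balaban1985BackgroundPropagators, Thm 3.9 p.413, (3.106) p.414] -/
theorem junction_windows_of_small (d : ℕ) {α₀' S A A₁ A₂ KT cg cb c1a c2a c3 c4 c5 cB cW B0 : ℝ}
    (hα : 0 ≤ α₀') (hS : 0 ≤ S) (hA : 0 ≤ A) (hA₁ : 0 ≤ A₁) (hA₂ : 0 ≤ A₂) (hKT : 0 ≤ KT) (hcg : 0 ≤ cg) (hcb : 0 ≤ cb)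
    (hc1a : 0 ≤ c1a) (hc2a : 0 ≤ c2a) (hc3 : 0 ≤ c3) (hc4 : 0 ≤ c4) (hcW : 0 ≤ cW) (hB0 : 0 ≤ B0)
    {θE AK θF KK κQ θQ BX θX BY θY B₁ θC κJ : ℝ} (hθE : θE = 32 * ((d : ℝ) + 1) ^ 2 * α₀' * S)
    (hAK : AK = A * cg * (1 - θE * A * cg)⁻¹)
    (hθF : θF = (2 * (8 * ((d : ℝ) + 1) ^ 2 * α₀') * S) * S * (A * A * 1 * c1a) + S * S * ((A + AK) * (AK * (θE * A) * 1 * c1a) * 1 * c2a) + S * ((2 * (8 * ((d : ℝ) + 1) ^ 2 * α₀') * S)) * (AK * AK * 1 * c1a))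
    (hKK : KK = KT * c4 * (1 - θF * KT * 1 * c3 * c4)⁻¹)
    (hκQ : κQ = S) (hθQ : θQ = 2 * (8 * ((d : ℝ) + 1) ^ 2 * α₀') * S)
    (hBX : BX = A₁ * (1 + cg * (θE * A * cg * (1 - θE * A * cg)⁻¹))) (hθX : θX = BX * θE * A * 1 * cb) (hBY : BY = ((d : ℝ) + 1) * A₂)
    (hθY : θY = AK * θE * BY * 1 * cb) (hB₁ : B₁ = max KT KK) (hθC : θC = B₁ * B₁ * θF * 1 * c5 ^ 2)
    (hκJ : κJ = 1 ^ 4 * cB ^ 2 * (κQ * κQ * θX * B₁ * BY + κQ * θQ * BX * B₁ * BY + κQ * κQ * BX * θC * BY + θQ * κQ * BX * B₁ * BY + κQ * κQ * BX * B₁ * θY))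
    (h1 : α₀' * (32 * ((d : ℝ) + 1) ^ 2 * S * A * cg) ≤ 1 / 2)
    (h2 : α₀' * (((2 * (8 * ((d : ℝ) + 1) ^ 2) * S) * S * (A * A * 1 * c1a) + S * S * ((A + (2 * (A * cg))) * ((2 * (A * cg)) * ((32 * ((d : ℝ) + 1) ^ 2 * S) * A) * 1 * c1a) * 1 * c2a) + S * ((2 * (8 * ((d : ℝ) + 1) ^ 2) * S)) * ((2 * (A * cg)) * (2 * (A * cg)) * 1 * c1a)) * KT * c3 * c4) ≤ 1 / 2)
    (h3 : α₀' * (2 * (((d : ℝ) + 3) * B0) * ((1 ^ 4 * cB ^ 2 * (S * S * ((A₁ * (1 + cg)) * (32 * ((d : ℝ) + 1) ^ 2 * S) * A * 1 * cb) * (max KT (2 * (KT * c4))) * (((d : ℝ) + 1) * A₂) + S * (2 * (8 * ((d : ℝ) + 1) ^ 2) * S) * (A₁ * (1 + cg)) * (max KT (2 * (KT * c4))) * (((d : ℝ) + 1) * A₂) + S * S * (A₁ * (1 + cg)) * ((max KT (2 * (KT * c4))) * (max KT (2 * (KT * c4))) * ((2 * (8 * ((d : ℝ) + 1) ^ 2)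 * S) * S * (A * A * 1 * c1a) + S * S * ((A + (2 * (A * cg))) * ((2 * (A * cg)) * ((32 * ((d : ℝ) + 1) ^ 2 * S) * A) * 1 * c1a) * 1 * c2a) + S * ((2 * (8 * ((d : ℝ) + 1) ^ 2) * S)) * ((2 * (A * cg)) * (2 * (A * cg)) * 1 * c1a)) * 1 * c5 ^ 2) * (((d : ℝ) + 1) * A₂) + (2 * (8 * ((d : ℝ) + 1) ^ 2) * S) * S * (A₁ * (1 + cg)) * (max KT (2 * (KT * c4))) * (((d : ℝ) + 1) * A₂) + S * S * (A₁ * (1 + cg)) * (max KT (2 * (KT * c4))) * ((2 * (A * cg)) * (32 * ((d : ℝ) + 1) ^ 2 * S) * (((d : ℝ) + 1) * A₂) * 1 * cb))) * S * cW)) ≤ 1 / 2) :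
    θE * A * cg < 1 ∧ θF * KT * 1 * c3 * c4 < 1 ∧ 2 * ((((d : ℝ) + 3) * B0) * (κJ * S * 1 * cW)) ≤ 1 := by
  have hE0 : 0 ≤ θE := by rw [hθE]; positivity
  have ht : θE * A * cg ≤ 1 / 2 := by
    have e : θE * A * cg = α₀' * (32 * ((d : ℝ) + 1) ^ 2 * S * A * cg) := by rw [hθE]; ring
    rw [e]; exact h1
  have ht0 : 0 ≤ θE * A * cg := by positivity
  have hinv : (1 - θE * A * cg)⁻¹ ≤ 2 := inv_one_sub_le_two ht
  have hinv0 : 0 ≤ (1 - θE * A * cg)⁻¹ := inv_nonneg.2 (by linarith only [ht])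
  have hAK0 : 0 ≤ AK := by rw [hAK]; exact mul_nonneg (mul_nonneg hA hcg) hinv0
  have hAKle : AK ≤ 2 * (A * cg) := by
    rw [hAK]
    calc A * cg * (1 - θE * A * cg)⁻¹ ≤ A * cg * 2 := mul_le_mul_of_nonneg_left hinv (mul_nonneg hA hcg)
      _ = 2 * (A * cg) := by ring
  have hrat : θE * A * cg * (1 - θE * A * cg)⁻¹ ≤ 1 := ratio_le_one ht
  have hBX0 : 0 ≤ BX := by rw [hBX]; exact mul_nonneg hA₁ (add_nonneg zero_le_one (mul_nonneg hcg (mul_nonneg ht0 hinv0)))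
  have hBXle : BX ≤ A₁ * (1 + cg) := by
    rw [hBX]
    gcongr
    exact mul_le_of_le_one_right hcg hrat
  -- `θ_F ≤ α₀′·Φ_F`
  have hθF0 : 0 ≤ θF := by rw [hθF]; positivity
  have hθFle : θF ≤ α₀' * ((2 * (8 * ((d : ℝ) + 1) ^ 2) * S) * S * (A * A * 1 * c1a) + S * S * ((A + (2 * (A * cg))) * ((2 * (A * cg)) * ((32 * ((d : ℝ) + 1) ^ 2 * S) * A) * 1 * c1a) * 1 * c2a) + S * ((2 * (8 * ((d : ℝ) + 1) ^ 2) * S)) * ((2 * (A * cg)) * (2 * (A * cg)) * 1 * c1a)) := by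
    rw [hθF]
    calc (2 * (8 * ((d : ℝ) + 1) ^ 2 * α₀') * S) * S * (A * A * 1 * c1a) + S * S * ((A + AK) * (AK * (θE * A) * 1 * c1a) * 1 * c2a) + S * ((2 * (8 * ((d : ℝ) + 1) ^ 2 * α₀') * S)) * (AK * AK * 1 * c1a)
        ≤ (2 * (8 * ((d : ℝ) + 1) ^ 2 * α₀') * S) * S * (A * A * 1 * c1a) + S * S * ((A + (2 * (A * cg))) * ((2 * (A * cg)) * (θE * A) * 1 * c1a) * 1 * c2a) + S * ((2 * (8 * ((d : ℝ) + 1) ^ 2 * α₀') * S)) * ((2 * (A * cg)) * (2 * (A * cg)) * 1 * c1a) := by gcongr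
      _ = α₀' * ((2 * (8 * ((d : ℝ) + 1) ^ 2) * S) * S * (A * A * 1 * c1a) + S * S * ((A + (2 * (A * cg))) * ((2 * (A * cg)) * ((32 * ((d : ℝ) + 1) ^ 2 * S) * A) * 1 * c1a) * 1 * c2a) + S * ((2 * (8 * ((d : ℝ) + 1) ^ 2) * S)) * ((2 * (A * cg)) * (2 * (A * cg)) * 1 * c1a)) := by rw [hθE]; ring
  -- window (ii)
  have hu : θF * KT * 1 * c3 * c4 ≤ 1 / 2 := by
    calc θF * KT * 1 * c3 * c4 ≤ α₀' * ((2 * (8 * ((d : ℝ) + 1) ^ 2) * S) * S * (A * A * 1 * c1a) + S * S * ((A + (2 * (A * cg))) * ((2 * (A * cg)) * ((32 * ((d : ℝ) + 1) ^ 2 * S) * A) * 1 * c1a) * 1 * c2a) + S * ((2 * (8 * ((d : ℝ) + 1) ^ 2) * S)) * ((2 * (A * cg)) * (2 * (A * cg)) * 1 * c1a)) * KT * 1 * c3 * c4 := by gcongr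
      _ = α₀' * (((2 * (8 * ((d : ℝ) + 1) ^ 2) * S) * S * (A * A * 1 * c1a) + S * S * ((A + (2 * (A * cg))) * ((2 * (A * cg)) * ((32 * ((d : ℝ) + 1) ^ 2 * S) * A) * 1 * c1a) * 1 * c2a) + S * ((2 * (8 * ((d : ℝ) + 1) ^ 2) * S)) * ((2 * (A * cg)) * (2 * (A * cg)) * 1 * c1a)) * KT * c3 * c4) := by ring
      _ ≤ 1 / 2 := h2
  have hu0 : 0 ≤ θF * KT * 1 * c3 * c4 := by positivity
  -- `K_K`, `B₁`
  have hKKle : KK ≤ 2 * (KT * c4) := by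
    rw [hKK]
    calc KT * c4 * (1 - θF * KT * 1 * c3 * c4)⁻¹ ≤ KT * c4 * 2 := mul_le_mul_of_nonneg_left (inv_one_sub_le_two hu) (mul_nonneg hKT hc4)
      _ = 2 * (KT * c4) := by ring
  have hB₁0 : 0 ≤ B₁ := by rw [hB₁]; exact hKT.trans (le_max_left _ _)
  have hB₁le : B₁ ≤ (max KT (2 * (KT * c4))) := by rw [hB₁]; exact max_le_max le_rfl hKKle
  -- the `θ`'s: one factor `α₀′` each
  have hθXle : θX ≤ α₀' * ((A₁ * (1 + cg)) * (32 * ((d : ℝ) + 1) ^ 2 * S) * A * 1 * cb) := by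
    rw [hθX]
    calc BX * θE * A * 1 * cb ≤ (A₁ * (1 + cg)) * θE * A * 1 * cb := by gcongr
      _ = α₀' * ((A₁ * (1 + cg)) * (32 * ((d : ℝ) + 1) ^ 2 * S) * A * 1 * cb) := by rw [hθE]; ring
  have hθYle : θY ≤ α₀' * ((2 * (A * cg)) * (32 * ((d : ℝ) + 1) ^ 2 * S) * (((d : ℝ) + 1) * A₂) * 1 * cb) := by
    rw [hθY, hBY]
    calc AK * θE * (((d : ℝ) + 1) * A₂) * 1 * cb ≤ (2 * (A * cg)) * θE * (((d : ℝ) + 1) * A₂) * 1 * cb := by gcongr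
      _ = α₀' * ((2 * (A * cg)) * (32 * ((d : ℝ) + 1) ^ 2 * S) * (((d : ℝ) + 1) * A₂) * 1 * cb) := by rw [hθE]; ring
  have hθCle : θC ≤ α₀' * ((max KT (2 * (KT * c4))) * (max KT (2 * (KT * c4))) * ((2 * (8 * ((d : ℝ) + 1) ^ 2) * S) * S * (A * A * 1 * c1a) + S * S * ((A + (2 * (A * cg))) * ((2 * (A * cg)) * ((32 * ((d : ℝ) + 1) ^ 2 * S) * A) * 1 * c1a) * 1 * c2a) + S * ((2 * (8 * ((d : ℝ) + 1) ^ 2) * S)) * ((2 * (A * cg)) * (2 * (A * cg)) * 1 * c1a)) * 1 * c5 ^ 2) := by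
    rw [hθC]
    calc B₁ * B₁ * θF * 1 * c5 ^ 2 ≤ (max KT (2 * (KT * c4))) * (max KT (2 * (KT * c4))) * (α₀' * ((2 * (8 * ((d : ℝ) + 1) ^ 2) * S) * S * (A * A * 1 * c1a) + S * S * ((A + (2 * (A * cg))) * ((2 * (A * cg)) * ((32 * ((d : ℝ) + 1) ^ 2 * S) * A) * 1 * c1a) * 1 * c2a) + S * ((2 * (8 * ((d : ℝ) + 1) ^ 2) * S)) * ((2 * (A * cg)) * (2 * (A * cg)) * 1 * c1a))) * 1 * c5 ^ 2 := by gcongr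
      _ = α₀' * ((max KT (2 * (KT * c4))) * (max KT (2 * (KT * c4))) * ((2 * (8 * ((d : ℝ) + 1) ^ 2) * S) * S * (A * A * 1 * c1a) + S * S * ((A + (2 * (A * cg))) * ((2 * (A * cg)) * ((32 * ((d : ℝ) + 1) ^ 2 * S) * A) * 1 * c1a) * 1 * c2a) + S * ((2 * (8 * ((d : ℝ) + 1) ^ 2) * S)) * ((2 * (A * cg)) * (2 * (A * cg)) * 1 * c1a)) * 1 * c5 ^ 2) := by ring
  have hθQe : θQ = α₀' * (2 * (8 * ((d : ℝ) + 1) ^ 2) * S) := by rw [hθQ]; ring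
  have hθX0 : 0 ≤ θX := by rw [hθX]; positivity
  have hθY0 : 0 ≤ θY := by rw [hθY, hBY]; positivity
  have hθC0 : 0 ≤ θC := by rw [hθC]; positivity
  have hθQ0 : 0 ≤ θQ := by rw [hθQ]; positivity
  -- `κ_J ≤ α₀′·Φ_J`, summand by summand
  have s1 : S * S * θX * B₁ * (((d : ℝ) + 1) * A₂) ≤ S * S * (α₀' * ((A₁ * (1 + cg)) * (32 * ((d : ℝ) + 1) ^ 2 * S) * A * 1 * cb)) * (max KT (2 * (KT * c4))) * (((d : ℝ) + 1) * A₂) := by gcongr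
  have s2 : S * (α₀' * (2 * (8 * ((d : ℝ) + 1) ^ 2) * S)) * BX * B₁ * (((d : ℝ) + 1) * A₂) ≤ S * (α₀' * (2 * (8 * ((d : ℝ) + 1) ^ 2) * S)) * (A₁ * (1 + cg)) * (max KT (2 * (KT * c4))) * (((d : ℝ) + 1) * A₂) := by gcongr
  have s3 : S * S * BX * θC * (((d : ℝ) + 1) * A₂) ≤ S * S * (A₁ * (1 + cg)) * (α₀' * ((max KT (2 * (KT * c4))) * (max KT (2 * (KT * c4))) * ((2 * (8 * ((d : ℝ) + 1) ^ 2) * S) * S * (A * A * 1 * c1a) + S * S * ((A + (2 * (A * cg))) * ((2 * (A * cg)) * ((32 * ((d : ℝ) + 1) ^ 2 * S) * A) * 1 * c1a) * 1 * c2a) + S * ((2 * (8 * ((d : ℝ) + 1) ^ 2) * S)) * ((2 * (A * cg)) * (2 * (A * cg)) * 1 * c1a)) * 1 * c5 ^ 2)) * (((d : ℝ) + 1) * A₂) := by gcongr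
  have s4 : (α₀' * (2 * (8 * ((d : ℝ) + 1) ^ 2) * S)) * S * BX * B₁ * (((d : ℝ) + 1) * A₂) ≤ (α₀' * (2 * (8 * ((d : ℝ) + 1) ^ 2) * S)) * S * (A₁ * (1 + cg)) * (max KT (2 * (KT * c4))) * (((d : ℝ) + 1) * A₂) := by gcongr
  have s5 : S * S * BX * B₁ * θY ≤ S * S * (A₁ * (1 + cg)) * (max KT (2 * (KT * c4))) * (α₀' * ((2 * (A * cg)) * (32 * ((d : ℝ) + 1) ^ 2 * S) * (((d : ℝ) + 1) * A₂) * 1 * cb)) := by gcongr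
  have hsum := add_le_add (add_le_add (add_le_add (add_le_add s1 s2) s3) s4) s5
  have hκJle : κJ ≤ α₀' * (1 ^ 4 * cB ^ 2 * (S * S * ((A₁ * (1 + cg)) * (32 * ((d : ℝ) + 1) ^ 2 * S) * A * 1 * cb) * (max KT (2 * (KT * c4))) * (((d : ℝ) + 1) * A₂) + S * (2 * (8 * ((d : ℝ) + 1) ^ 2) * S) * (A₁ * (1 + cg)) * (max KT (2 * (KT * c4))) * (((d : ℝ) + 1) * A₂) + S * S * (A₁ * (1 + cg)) * ((max KT (2 * (KT * c4))) * (max KT (2 * (KT * c4))) * ((2 * (8 * ((d : ℝ) + 1) ^ 2) * S) * S * (A * A * 1 * c1a) + S * S * ((A + (2 * (A * cg))) * ((2 * (A * cg)) * ((32 * ((d : ℝ) + 1) ^ 2 * S) * A) * 1 * c1a) * 1 * c2a) + S * ((2 * (8 * ((d : ℝ) + 1) ^ 2) * S)) * ((2 * (A * cg)) * (2 * (A * cg)) * 1 * c1a)) * 1 * c5 ^ 2) * (((d : ℝ) + 1) * A₂) + (2 * (8 * ((d : ℝ) + 1) ^ 2) * S) * S * (A₁ * (1 + cg)) * (max KT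 (2 * (KT * c4))) * (((d : ℝ) + 1) * A₂) + S * S * (A₁ * (1 + cg)) * (max KT (2 * (KT * c4))) * ((2 * (A * cg)) * (32 * ((d : ℝ) + 1) ^ 2 * S) * (((d : ℝ) + 1) * A₂) * 1 * cb))) := by
    rw [hκJ, hκQ, hBY, hθQe]
    calc 1 ^ 4 * cB ^ 2 * (S * S * θX * B₁ * (((d : ℝ) + 1) * A₂) + S * (α₀' * (2 * (8 * ((d : ℝ) + 1) ^ 2) * S)) * BX * B₁ * (((d : ℝ) + 1) * A₂) + S * S * BX * θC * (((d : ℝ) + 1) * A₂) + (α₀' * (2 * (8 * ((d : ℝ) + 1) ^ 2) * S)) * S * BX * B₁ * (((d : ℝ) + 1) * A₂) + S * S * BX * B₁ * θY)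
        ≤ 1 ^ 4 * cB ^ 2 * (S * S * (α₀' * ((A₁ * (1 + cg)) * (32 * ((d : ℝ) + 1) ^ 2 * S) * A * 1 * cb)) * (max KT (2 * (KT * c4))) * (((d : ℝ) + 1) * A₂) + S * (α₀' * (2 * (8 * ((d : ℝ) + 1) ^ 2) * S)) * (A₁ * (1 + cg)) * (max KT (2 * (KT * c4))) * (((d : ℝ) + 1) * A₂) + S * S * (A₁ * (1 + cg)) * (α₀' * ((max KT (2 * (KT * c4))) * (max KT (2 * (KT * c4))) * ((2 * (8 * ((d : ℝ) + 1) ^ 2) * S) * S * (A * A * 1 * c1a) + S * S * ((A + (2 * (A * cg))) * ((2 * (A * cg)) * ((32 * ((d : ℝ) + 1) ^ 2 * S) * A) * 1 * c1a) * 1 * c2a) + S * ((2 * (8 * ((d : ℝ) + 1) ^ 2) * S)) * ((2 * (A * cg)) * (2 * (A * cg)) * 1 * c1a)) * 1 * c5 ^ 2)) * (((d : ℝ) + 1) * A₂) + (α₀' * (2 * (8 * ((d : ℝ) + 1) ^ 2) * S)) * S * (A₁ * (1 + cg)) * (max KT (2 * (KT * c4))) * (((d : ℝ) + 1) * A₂)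 + S * S * (A₁ * (1 + cg)) * (max KT (2 * (KT * c4))) * (α₀' * ((2 * (A * cg)) * (32 * ((d : ℝ) + 1) ^ 2 * S) * (((d : ℝ) + 1) * A₂) * 1 * cb))) :=
          mul_le_mul_of_nonneg_left hsum (by positivity)
      _ = α₀' * (1 ^ 4 * cB ^ 2 * (S * S * ((A₁ * (1 + cg)) * (32 * ((d : ℝ) + 1) ^ 2 * S) * A * 1 * cb) * (max KT (2 * (KT * c4))) * (((d : ℝ) + 1) * A₂) + S * (2 * (8 * ((d : ℝ) + 1) ^ 2) * S) * (A₁ * (1 + cg)) * (max KT (2 * (KT * c4))) * (((d : ℝ) + 1) * A₂) + S * S * (A₁ * (1 + cg)) * ((max KT (2 * (KT * c4))) * (max KT (2 * (KT * c4))) * ((2 * (8 * ((d : ℝ) + 1) ^ 2) * S) * S * (A * A * 1 * c1a) + S * S * ((A + (2 * (A * cg))) * ((2 * (A * cg)) * ((32 * ((d : ℝ) + 1) ^ 2 * S) * A) * 1 * c1a) * 1 * c2a) + S * ((2 * (8 * ((d : ℝ) + 1) ^ 2) * S)) * ((2 * (A * cg)) * (2 * (A * cg)) * 1 * c1a)) *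 1 * c5 ^ 2) * (((d : ℝ) + 1) * A₂) + (2 * (8 * ((d : ℝ) + 1) ^ 2) * S) * S * (A₁ * (1 + cg)) * (max KT (2 * (KT * c4))) * (((d : ℝ) + 1) * A₂) + S * S * (A₁ * (1 + cg)) * (max KT (2 * (KT * c4))) * ((2 * (A * cg)) * (32 * ((d : ℝ) + 1) ^ 2 * S) * (((d : ℝ) + 1) * A₂) * 1 * cb))) := by ring
  have hκJ0 : 0 ≤ κJ := by rw [hκJ, hκQ, hBY]; positivity
  refine ⟨by linarith only [ht], by linarith only [hu], ?_⟩
  calc 2 * ((((d : ℝ) + 3) * B0) * (κJ * S * 1 * cW)) ≤ 2 * ((((d : ℝ) + 3) * B0) * (α₀' * (1 ^ 4 * cB ^ 2 * (S * S * ((A₁ * (1 + cg)) * (32 * ((d : ℝ) + 1) ^ 2 * S) * A * 1 * cb) * (max KT (2 * (KT * c4))) * (((d : ℝ) + 1) * A₂) + S * (2 * (8 * ((d : ℝ) + 1) ^ 2) * S) * (A₁ * (1 + cg)) * (max KT (2 * (KT * c4))) * (((d : ℝ) + 1) * A₂) + S * S * (A₁ * (1 + cg)) * ((max KT (2 * (KT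 * c4))) * (max KT (2 * (KT * c4))) * ((2 * (8 * ((d : ℝ) + 1) ^ 2) * S) * S * (A * A * 1 * c1a) + S * S * ((A + (2 * (A * cg))) * ((2 * (A * cg)) * ((32 * ((d : ℝ) + 1) ^ 2 * S) * A) * 1 * c1a) * 1 * c2a) + S * ((2 * (8 * ((d : ℝ) + 1) ^ 2) * S)) * ((2 * (A * cg)) * (2 * (A * cg)) * 1 * c1a)) * 1 * c5 ^ 2) * (((d : ℝ) + 1) * A₂) + (2 * (8 * ((d : ℝ) + 1) ^ 2) * S) * S * (A₁ * (1 + cg)) * (max KT (2 * (KT * c4))) * (((d : ℝ) + 1) * A₂) + S * S * (A₁ * (1 + cg)) * (max KT (2 * (KT * c4))) * ((2 * (A * cg)) * (32 * ((d : ℝ) + 1) ^ 2 * S) * (((d : ℝ) + 1) * A₂) * 1 * cb))) * S * 1 * cW)) := by gcongr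
    _ = α₀' * (2 * (((d : ℝ) + 3) * B0) * ((1 ^ 4 * cB ^ 2 * (S * S * ((A₁ * (1 + cg)) * (32 * ((d : ℝ) + 1) ^ 2 * S) * A * 1 * cb) * (max KT (2 * (KT * c4))) * (((d : ℝ) + 1) * A₂) + S * (2 * (8 * ((d : ℝ) + 1) ^ 2) * S) * (A₁ * (1 + cg)) * (max KT (2 * (KT * c4))) * (((d : ℝ) + 1) * A₂) + S * S * (A₁ * (1 + cg)) * ((max KT (2 * (KT * c4))) * (max KT (2 * (KT * c4))) * ((2 * (8 * ((d : ℝ) + 1) ^ 2) * S) * S * (A * A * 1 * c1a) + S * S * ((A + (2 * (A * cg))) * ((2 * (A * cg)) * ((32 * ((d : ℝ) + 1) ^ 2 * S) * A) * 1 * c1a) * 1 * c2a) + S * ((2 * (8 * ((d : ℝ) + 1) ^ 2) * S)) * ((2 * (A * cg)) * (2 * (A * cg)) * 1 * c1a)) * 1 * c5 ^ 2) * (((d : ℝ) + 1) * A₂) + (2 * (8 * ((d : ℝ) + 1) ^ 2) * S) * S * (A₁ * (1 + cg)) * (max KT (2 * (KT * c4))) * (((d : ℝ) + 1) * A₂)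 + S * S * (A₁ * (1 + cg)) * (max KT (2 * (KT * c4))) * ((2 * (A * cg)) * (32 * ((d : ℝ) + 1) ^ 2 * S) * (((d : ℝ) + 1) * A₂) * 1 * cb))) * S * cW)) := by ring
    _ ≤ 1 / 2 := h3
    _ ≤ 1 := by norm_num

/-- ★ **THE JUNCTION's CLASS SIZE**: the three located smallness conditions hold for every `0 ≤ α₀′ ≤ a₀` with
`a₀ = min (1∕(2(Φ₁+1))) (min (1∕(2(Φ₂+1))) (1∕(2(Φ₃+1)))) > 0` (`Φ₁, Φ₂, Φ₃ ≥ 0` the polynomials of `junction_windows_of_small`).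
[cite: Balaban1985Averaging, Prop. 2 p.26 («α₀ sufficiently small»); Balaban1985BackgroundPropagators, Thm 3.9 p.413] -/
theorem exists_junction_size (d : ℕ) {S A A₁ A₂ KT cg cb c1a c2a c3 c4 c5 cB cW B0 : ℝ}
    (hS : 0 ≤ S) (hA : 0 ≤ A) (hA₁ : 0 ≤ A₁) (hA₂ : 0 ≤ A₂) (hKT : 0 ≤ KT) (hcg : 0 ≤ cg) (hcb : 0 ≤ cb)
    (hc1a : 0 ≤ c1a) (hc2a : 0 ≤ c2a) (hc3 : 0 ≤ c3) (hc4 : 0 ≤ c4) (hcW : 0 ≤ cW) (hB0 : 0 ≤ B0) :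
    ∃ a₀ : ℝ, 0 < a₀ ∧ ∀ α₀' : ℝ, 0 ≤ α₀' → α₀' ≤ a₀ →
      α₀' * (32 * ((d : ℝ) + 1) ^ 2 * S * A * cg) ≤ 1 / 2 ∧
      α₀' * (((2 * (8 * ((d : ℝ) + 1) ^ 2) * S) * S * (A * A * 1 * c1a) + S * S * ((A + (2 * (A * cg))) * ((2 * (A * cg)) * ((32 * ((d : ℝ) + 1) ^ 2 * S) * A) * 1 * c1a) * 1 * c2a) + S * ((2 * (8 * ((d : ℝ) + 1) ^ 2) * S)) * ((2 * (A * cg)) * (2 * (A * cg)) * 1 * c1a)) * KT * c3 * c4) ≤ 1 / 2 ∧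
      α₀' * (2 * (((d : ℝ) + 3) * B0) * ((1 ^ 4 * cB ^ 2 * (S * S * ((A₁ * (1 + cg)) * (32 * ((d : ℝ) + 1) ^ 2 * S) * A * 1 * cb) * (max KT (2 * (KT * c4))) * (((d : ℝ) + 1) * A₂) + S * (2 * (8 * ((d : ℝ) + 1) ^ 2) * S) * (A₁ * (1 + cg)) * (max KT (2 * (KT * c4))) * (((d : ℝ) + 1) * A₂) + S * S * (A₁ * (1 + cg)) * ((max KT (2 * (KT * c4))) * (max KT (2 * (KT * c4))) * ((2 * (8 * ((d : ℝ) + 1) ^ 2) * S) * S * (A * A * 1 * c1a) + S * S * ((A + (2 * (A * cg))) * ((2 * (A * cg)) * ((32 * ((d : ℝ) + 1) ^ 2 * S) * A) * 1 * c1a) * 1 * c2a) + S * ((2 * (8 * ((d : ℝ) + 1) ^ 2) * S)) * ((2 * (A * cg)) * (2 * (A * cg)) * 1 * c1a)) * 1 * c5 ^ 2) * (((d : ℝ) + 1) * A₂) + (2 * (8 * ((d : ℝ) + 1) ^ 2) * S) * S * (A₁ * (1 + cg)) * (max KT (2 * (KT * c4))) * (((d : ℝ) + 1) * A₂) + S *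 S * (A₁ * (1 + cg)) * (max KT (2 * (KT * c4))) * ((2 * (A * cg)) * (32 * ((d : ℝ) + 1) ^ 2 * S) * (((d : ℝ) + 1) * A₂) * 1 * cb))) * S * cW)) ≤ 1 / 2 := by
  have hΦ₁ : 0 ≤ 32 * ((d : ℝ) + 1) ^ 2 * S * A * cg := by positivity
  have hKT2 : 0 ≤ (max KT (2 * (KT * c4))) := hKT.trans (le_max_left _ _)
  have hΦ₂ : 0 ≤ ((2 * (8 * ((d : ℝ) + 1) ^ 2) * S) * S * (A * A * 1 * c1a) + S * S * ((A + (2 * (A * cg))) * ((2 * (A * cg)) * ((32 * ((d : ℝ) + 1) ^ 2 * S) * A) * 1 * c1a) * 1 * c2a) + S * ((2 * (8 * ((d : ℝ) + 1) ^ 2) * S)) * ((2 * (A * cg)) * (2 * (A * cg)) * 1 * c1a)) * KT * c3 * c4 := by positivity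
  have hΦ₃ : 0 ≤ 2 * (((d : ℝ) + 3) * B0) * ((1 ^ 4 * cB ^ 2 * (S * S * ((A₁ * (1 + cg)) * (32 * ((d : ℝ) + 1) ^ 2 * S) * A * 1 * cb) * (max KT (2 * (KT * c4))) * (((d : ℝ) + 1) * A₂) + S * (2 * (8 * ((d : ℝ) + 1) ^ 2) * S) * (A₁ * (1 + cg)) * (max KT (2 * (KT * c4))) * (((d : ℝ) + 1) * A₂) + S * S * (A₁ * (1 + cg)) * ((max KT (2 * (KT * c4))) * (max KT (2 * (KT * c4))) * ((2 * (8 * ((d : ℝ) + 1) ^ 2) * S) * S * (A * A * 1 * c1a) + S * S * ((A + (2 * (A * cg))) * ((2 * (A * cg)) * ((32 * ((d : ℝ) + 1) ^ 2 * S) * A) * 1 * c1a) * 1 * c2a) + S * ((2 * (8 * ((d : ℝ) + 1) ^ 2) * S)) * ((2 * (A * cg)) * (2 * (A * cg)) * 1 * c1a)) * 1 * c5 ^ 2) * (((d : ℝ) + 1) * A₂) + (2 * (8 * ((d : ℝ) + 1) ^ 2) * S) * S * (A₁ * (1 + cg)) * (max KT (2 * (KT * c4))) * (((d : ℝ) +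 1) * A₂) + S * S * (A₁ * (1 + cg)) * (max KT (2 * (KT * c4))) * ((2 * (A * cg)) * (32 * ((d : ℝ) + 1) ^ 2 * S) * (((d : ℝ) + 1) * A₂) * 1 * cb))) * S * cW) := by positivity
  refine ⟨min (1 / (2 * (32 * ((d : ℝ) + 1) ^ 2 * S * A * cg + 1))) (min (1 / (2 * (((2 * (8 * ((d : ℝ) + 1) ^ 2) * S) * S * (A * A * 1 * c1a) + S * S * ((A + (2 * (A * cg))) * ((2 * (A * cg)) * ((32 * ((d : ℝ) + 1) ^ 2 * S) * A) * 1 * c1a) * 1 * c2a) + S * ((2 * (8 * ((d : ℝ) + 1) ^ 2) * S)) * ((2 * (A * cg)) * (2 * (A * cg)) * 1 * c1a)) * KT * c3 * c4 + 1)))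
      (1 / (2 * (2 * (((d : ℝ) + 3) * B0) * ((1 ^ 4 * cB ^ 2 * (S * S * ((A₁ * (1 + cg)) * (32 * ((d : ℝ) + 1) ^ 2 * S) * A * 1 * cb) * (max KT (2 * (KT * c4))) * (((d : ℝ) + 1) * A₂) + S * (2 * (8 * ((d : ℝ) + 1) ^ 2) * S) * (A₁ * (1 + cg)) * (max KT (2 * (KT * c4))) * (((d : ℝ) + 1) * A₂) + S * S * (A₁ * (1 + cg)) * ((max KT (2 * (KT * c4))) * (max KT (2 * (KT * c4))) * ((2 * (8 * ((d : ℝ) + 1) ^ 2) * S) * S * (A * A * 1 * c1a) + S * S * ((A + (2 * (A * cg))) * ((2 * (A * cg)) * ((32 * ((d : ℝ) + 1) ^ 2 * S) * A) * 1 * c1a) * 1 * c2a) + S * ((2 * (8 * ((d : ℝ) + 1) ^ 2) * S)) * ((2 * (A * cg)) * (2 * (A * cg)) * 1 * c1a)) * 1 * c5 ^ 2) * (((d : ℝ) + 1) * A₂) + (2 * (8 * ((d : ℝ) + 1) ^ 2) * S) * S * (A₁ * (1 + cg)) * (max KT (2 * (KT * c4))) * (((d : ℝ) + 1) * A₂)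 + S * S * (A₁ * (1 + cg)) * (max KT (2 * (KT * c4))) * ((2 * (A * cg)) * (32 * ((d : ℝ) + 1) ^ 2 * S) * (((d : ℝ) + 1) * A₂) * 1 * cb))) * S * cW) + 1)))), ?_, fun α₀' _ hle => ?_⟩
  · exact lt_min (by positivity) (lt_min (by positivity) (by positivity))
  · exact ⟨small_of_le hΦ₁ (hle.trans (min_le_left _ _)), small_of_le hΦ₂ (hle.trans ((min_le_right _ _).trans (min_le_left _ _))),
      small_of_le hΦ₃ (hle.trans ((min_le_right _ _).trans (min_le_right _ _)))⟩


/-! ## §2 ★★★★★ The interface of record with the junction windows INTERNALISED: «α₀′ sufficiently small» -/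

section Cover

open Node00 B6KLevelCensusIndexV1
open B7Prop1Explicit renaming Site → LSite
open B7Prop2Explicit (unitaryUnits C0 c2')
open B6GlobalChartV1 (PV)
open B6Ineq2142KLevelV1 (β)
open B6RandomWalk (HasMajorant c1_nonneg)
open B9Thm34Ext (toB6)
open B9FromB6 (EBlock)
open B9CubeLettersInvReadings (kernelFamilyBInv kernelFamilySInv)
open B9GeoNormsKLevelV1 (geo9K)
open B9Eq352DivFormLetters (conj)
open B8Thm2TorusCoverOfEBlockSymG (hThm2Cover_of_prop6_eBlockSymG_exists)
open B8Ineq132 (InAk)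
open B8Thm2TorusLettersPerOfKnit (bgY)
open B9Eq316AveragingTransposeZd (betaTau alphaQ)
open B7Prop2SpecialUnitary (specialUnitaryUnits)
open B8Thm2TorusAt (Thm2TorusAt)
open T4TermwiseTorus (IsPeriodic)
open B8Thm2T3FamilyBinder (P_eq_PV)
open T3ContinuumYM3Torus (T3Family)
open T3SectALandauChart (eta eta_pos)
open scoped Matrix Matrix.Norms.L2Operator

variable {ℓ : ℕ} {hL : Odd (ℓ + 1) ∧ 1 < ℓ + 1} {hd₃ : 1 ≤ 2 + 1}
variable [instF : ∀ i : KIdx 2 ℓ hd₃ hL 1 1, Fintype (geo9K i).Site] [instD : ∀ i : KIdx 2 ℓ hd₃ hL 1 1, DecidableEq (geo9K i).Site]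

/-- ★★★★★ **THE TORUS THM 2 COVER INTERFACE OF RECORD, «α₀′ SUFFICIENTLY SMALL» FORM** (`d + 1 = 3`, `N = 2`): 5-ter's `hThm2Cover_of_prop6_eBlockSymG_exists` with the
junction's (2.61)-dimensions, named constants and three numeric windows INTERNALISED — given `τ = tr`, `M ≥ 1`, `(δ_E, α)`, `len`, a basis `b`, `Rr Hp Hg`, the
junction's rate ladder (non-vacuous: 5-bis `rateLadder_nonvacuous`) and the def-Y's-side constants `K_G, K_T ≥ 0`: THERE ARE `d′, A₀` such that for every `a′ ≥ A₀`
and every `B_E > 0` THERE IS `a_J > 0` (the junction's class size, §1) such that for every `a_T` in FILE 4's windows with F7's condition, every class parameter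
`0 < α₀′ ≤ a_J` with `C₀α₀′ ≤ ⅓`, `2α₀′ ≤ c₂′` and the one-level slack `a_T·L² < α₀′`: `∃ a₀′ > 0, ∃ k₀, ∃ c_α > 0, ∀ c_L …, ∃ B₁ B₂ c₁ > 0, ∀ F : T3Family,
F.L = ℓ + 1 → ∀ n < K`, [(1ₛ) ∧ (Eₛ) ∧ (Gₛ) ∧ (Cₛ) at the cover torus' shape-members, in M5.7 ∕ M5.5 ∕ M5.6's currencies with constants `(B_E, δ_E)`, `(K_G, δ₀)`,
`(K_T, δ₀)`] → `P ∣ P′ ∧ L^{K−n} ∣ P ∧ Thm2TorusAt (ℓ+1) (K − n) P′ (eta F n K) 0 B₁ B₂ c₁ len SU(2) ⊤`.  Displayed: the four member statements, FILE 4 ∕ F7's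
numeric windows in `a_T`, [B7]'s class windows in `α₀′`.  HONEST SCOPE: nothing here inhabits (1ₛ)(Eₛ)(Gₛ)(Cₛ); `stub_PV3A` NOT discharged; no summit ∕ node
statement proved; nothing continuum ∕ ℝ⁴ ∕ OS — the Yang–Mills mass gap is NOT proved by any of this.
[cite: Balaban1985RegularSpaces, Thm 2 p.83, (1.29) p.81, (1.33)–(1.39) pp.82–83, (1.7) p.77, (1.58)–(1.60) pp.86–87; Balaban1985Averaging, Prop. 2 p.26, (52)–(53) pp.26–27; Balaban1985BackgroundPropagators, p.408 l.30–34, Thm 3.1 (3.42) p.397, Thm 3.2 (3.48) p.398, (3.25)–(3.27) p.394–395, (3.49) p.399, Thm 3.9 p.413, (3.106) p.414; Balaban1984PropagatorsII, (2.50)–(2.55) p.232, Lemma 2.1 (2.60)–(2.63) p.234, (2.66)–(2.67) p.234; Balaban1985UV3, (1)–(3) p.256] -/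
theorem hThm2Cover_of_prop6_eBlockSymG_small (hℓ : 4 ≤ ℓ)
    (τ : (Matrix (Fin 2) (Fin 2) ℂ) →ₗ[ℂ] ℂ) (hτ : ∀ a, τ a = Matrix.trace a) (hτt : ∀ a b, τ (a * b) = τ (b * a))
    {Cτ : ℝ} (hCτ : ∀ x y : (Matrix (Fin 2) (Fin 2) ℂ), |(τ (star x * y)).re| ≤ Cτ * ‖x‖ * ‖y‖)
    {M : ℝ} (hM1 : 1 ≤ M) {δE α : ℝ} (hδE : 0 < δE) (hαE0 : 0 < α) (hα1 : α < 1)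
    {len : LSite (2 + 1) → ℝ}
    {ι : Type} [Fintype ι] [DecidableEq ι] (b : Module.Basis ι ℝ (Matrix (Fin 2) (Fin 2) ℂ)) {M₂ : ℝ} (hM₂ : 0 ≤ M₂)
    (hrepr : ∀ (v : (Matrix (Fin 2) (Fin 2) ℂ)) (j : ι), |b.repr v j| ≤ M₂ * ‖v‖)
    (Rr : ℝ) (Hp Hg : Prop)
    {δ₀ αg δc δb αb βb δ δ₁ δ₂ δ₃ αst α' αC δ₅ α₅ β₅ δB αB βB ρ δW₁ αW₁ δW₂ αW₂ : ℝ}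
    (hδ₀ : 0 ≤ δ₀) (hαg1 : αg ≤ 1) (pαg : 0 < αg * δ₀) (hαδg : 0 ≤ (1 - αg) * δ₀) (hδc : 0 ≤ δc) (pαb : 0 < αb * δb) (pβb : 0 < βb * δb) (hαb : 0 ≤ αb)
    (hβb : 0 ≤ βb) (hδb : 0 ≤ δb) (hrb : δc + (αb + βb) * δb ≤ (1 - αg) * δ₀) (hδ : δ ≤ (1 - αg) * δ₀) (hδ₁ : δ₁ = (1 - α') * ((1 - αst) * δ))
    (hδ₂ : δ₂ = (1 - α') * ((1 - αst) * δ₁)) (hδ₃ : δ₃ = (1 - α') * ((1 - αst) * δ₂)) (pαst : 0 < αst * δ) (pαst₁ : 0 < αst * δ₁) (pαst₂ : 0 < αst * δ₂)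
    (hα'0 : 0 ≤ α') (hα'1 : α' ≤ 1) (hδ' : 0 ≤ (1 - αst) * δ) (hδ'₂ : 0 ≤ (1 - αst) * δ₁) (hδ'₃ : 0 ≤ (1 - αst) * δ₂) (p₁ : 0 < α' * ((1 - αst) * δ))
    (p₂ : 0 < α' * ((1 - αst) * δ₁)) (p₃ : 0 < α' * ((1 - αst) * δ₂)) (hδ₃0 : 0 ≤ δ₃) (hαC0 : 0 ≤ αC) (hαC1 : αC ≤ 1) (pαC : 0 < αC * δ₃)
    (hαδ₄ : 0 ≤ (1 - αC) * δ₃) (pα₅ : 0 < α₅ * δ₅) (pβ₅ : 0 < β₅ * δ₅) (hα₅ : 0 ≤ α₅) (hβ₅ : 0 ≤ β₅) (hδ₅ : 0 ≤ δ₅)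
    (hr₅ : δc + 2 * (α₅ + β₅) * δ₅ ≤ (1 - αC) * δ₃) (pαB : 0 < αB * δB) (pβB : 0 < βB * δB) (hρ : 0 ≤ ρ) (hαB : 0 ≤ αB) (hβB : 0 ≤ βB) (hδB : 0 ≤ δB)
    (hrB : ρ + (2 * αB + βB) * δB ≤ δc) (pαW₁ : 0 < αW₁ * δW₁) (pαW₂ : 0 < αW₂ * δW₂) (hsplit : αW₁ * δW₁ + αW₂ * δW₂ ≤ ρ)
    {KG KT : ℝ} (hKG : 0 ≤ KG) (hK : 0 ≤ KT) :
    letI : CStarAlgebra (Matrix (Fin 2) (Fin 2) ℂ) := {}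
    ∃ d' A₀ : ℕ, ∀ a' : ℕ, A₀ ≤ a' → ∀ BE : ℝ, 0 < BE → ∃ aJ : ℝ, 0 < aJ ∧
    ∀ aT : ℝ, 0 < aT → aT ≤ alphaQ (2 + 1) (ℓ + 1) / ((ℓ + 1 : ℕ) : ℝ) ^ 2 → C0 (2 + 1) * aT ≤ 1 / 3 → 2 * aT ≤ c2' (2 + 1) (ℓ + 1) →
      2 * ((48 * (((2 : ℕ) : ℝ) + 1) + 14 * ((2 : ℕ) : ℝ) * M + (32 * (((2 : ℕ) : ℝ) + 2) ^ 2 +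
        12 * (((2 : ℕ) : ℝ) + 1) ^ 2 * (13344 * (((2 : ℕ) : ℝ) + 1) * (((2 : ℕ) : ℝ) + 2) ^ 2 * (((2 : ℕ) : ℝ) + 5) * (((ℓ + 1 : ℕ) : ℝ)) ^ (2 + 4)) *
          (Cτ * betaTau τ))) * aT) * (2 * (BE * B6.c1 d' δE (1 - α) * (((ℓ + 1 : ℕ) : ℝ)) ^ 4)) ≤ 1 →
    ∀ α₀' : ℝ, 0 < α₀' → α₀' ≤ aJ → C0 (2 + 1) * α₀' ≤ 1 / 3 → 2 * α₀' ≤ c2' (2 + 1) (ℓ + 1) → aT * (((ℓ + 1 : ℕ) : ℝ)) ^ (2 * 1) < α₀' →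
    ∃ a₀' : ℝ, 0 < a₀' ∧ ∃ k₀ : ℕ, ∃ cα : ℝ, 0 < cα ∧
    ∀ cL : ℝ, 0 < cL → cL * (((ℓ + 1 : ℕ) : ℝ)) ^ 2 < a₀' →
      cL ≤ min (1 / 16) (min aT (min aT (1 / (2 * (2 * (2 * (BE * B6.c1 d' δE (1 - α) * (((ℓ + 1 : ℕ) : ℝ)) ^ 4))) * (14 * ((2 + 1 - 1 : ℕ) : ℝ)) * M + 1)))) →
      cL ≤ cα →
    ∃ B₁' B₂ c₁ : ℝ, 0 < B₁' ∧ 0 < B₂ ∧ 0 < c₁ ∧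
    ∀ F : T3Family, F.L = ℓ + 1 → ∀ (n K : ℕ), n < K →
      (∀ (i : KIdx 2 ℓ hd₃ hL 1 1) (m' : ℕ), 1 ≤ m' → m' ≤ K - n → i.k = m' + 1 → (∀ x, i.D.lev x = m') → i.Mh = (ℓ + 1) ^ a' →
        i.cf = (((ℓ + 1 : ℕ) : ℝ)) ^ (m' + 1) →
        (∀ ι : IBondY i, i.w ι = i.cf ^ 2 * (((((ℓ + 1 : ℕ) : ℝ)) ^ (ι.1.1 : ℕ)) ^ (2 + 1) * (1 / (((ℓ + 1 : ℕ) : ℝ)) ^ (ι.1.1 : ℕ)) ^ 2)) →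
        (PV 2 ℓ i.m i.K hd₃ hL).sitesPerDir 0 = (PV 2 ℓ (F.m + k₀) K hd₃ hL).sitesPerDir 0 →
        ∀ (α₀ : ℝ) (U₀ : LSite (2 + 1) → Fin (2 + 1) → (Matrix (Fin 2) (Fin 2) ℂ)ˣ),
        (∀ x κ, U₀ x κ ∈ B7Prop2Explicit.unitaryUnits (Matrix (Fin 2) (Fin 2) ℂ)) →
        IsPeriodic ((PV 2 ℓ (F.m + k₀) K hd₃ hL).sitesPerDir 0) U₀ → 0 < α₀ → α₀ ≤ aT →
        InAk (ℓ + 1) m' (eta F n K) α₀ (fun _ => (Set.univ : Set (LSite (2 + 1)))) U₀ →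
          IsUnit (deltaAY i (parSymY i) (parBY i) (GpY i (parSymY i)) (bgY i U₀)) ∧
          (∀ (B : B9.Backgrounds) (cfg : B.Cfg → CfgY (Matrix (Fin 2) (Fin 2) ℂ) i) (par : BondParY (Matrix (Fin 2) (Fin 2) ℂ) i) (U₁ : B.Cfg),
            cfg U₁ = bgY i U₀ →
            EBlock (kernelFamilyBInv i B cfg (GAY i (parSymY i) (parBY i) (GpY i (parSymY i))) par) BE δE U₁) ∧
          (∀ (B : B9.Backgrounds) (cfg : B.Cfg → CfgY (Matrix (Fin 2) (Fin 2) ℂ) i) (U₁ : B.Cfg), cfg U₁ = (bgY i U₀) →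
              EBlock (kernelFamilySInv i B cfg (GpY i (parSymY i)) (parSymY i)) KG δ₀ U₁) ∧
            (∀ ιB : BlkY i → IBondY i, (∀ s, β i.hN i.D i.hk (ιB s) = s) →
              HasMajorant (g := toB6 (geo9K i) 1 Hg) (fun q : BlkY i × ι => ιB q.1)
                (conj b ((etaS i ^ 2 * etaS i ^ 2)⁻¹ • (XinvY i (parSymY i) (GpY i (parSymY i)) (bgY i U₀)).restrictScalars ℝ))
                (fun a a' => KT * ((geo9K i).len a ^ 4)⁻¹ * Real.exp (-(δ₀ * (geo9K i).dist a a'))))) →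
      (((F.P K).sitesPerDir 0 : ℕ) : ℤ) ∣ (((PV 2 ℓ (F.m + k₀) K hd₃ hL).sitesPerDir 0 : ℕ) : ℤ) ∧
      (((ℓ + 1 : ℕ) : ℤ)) ^ (K - n) ∣ (((F.P K).sitesPerDir 0 : ℕ) : ℤ) ∧
      Thm2TorusAt (ℓ + 1) (K - n) ((((PV 2 ℓ (F.m + k₀) K hd₃ hL).sitesPerDir 0 : ℕ) : ℤ)) (eta F n K) 0 B₁' B₂ c₁ len
        (specialUnitaryUnits (Fin 2)) (fun _ => True) := by
  letI : CStarAlgebra (Matrix (Fin 2) (Fin 2) ℂ) := {}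
  obtain ⟨d', dg, db, d₁, d₂, d₃, d₄, d₅, dB, dW, A₀, H⟩ := hThm2Cover_of_prop6_eBlockSymG_exists (hd₃ := hd₃) (hL := hL) (len := len) hℓ τ hτ hτt hCτ
    hM1 hδE hαE0 hα1 b hM₂ hrepr Rr Hp Hg hδ₀ hαg1 pαg hαδg hδc pαb pβb hαb hβb hδb hrb hδ hδ₁ hδ₂ hδ₃ pαst pαst₁ pαst₂ hα'0 hα'1 hδ' hδ'₂ hδ'₃ p₁ p₂ p₃ hδ₃0 hαC0 hαC1 pαC hαδ₄ pα₅ pβ₅ hα₅ hβ₅ hδ₅ hr₅ pαB pβB hρ hαB hβB hδB hrB pαW₁ pαW₂ hsplit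
  refine ⟨d', A₀, fun a' ha' BE hBE => ?_⟩
  have hSb : 0 ≤ ∑ j, ‖b j‖ := Finset.sum_nonneg fun _ _ => norm_nonneg _
  have hS : 0 ≤ M₂ * ∑ j, ‖b j‖ := mul_nonneg hM₂ hSb
  have hA : 0 ≤ M₂ * (∑ j, ‖b j‖) * KG := mul_nonneg hS hKG
  have hB0 : 0 ≤ (BE * B6.c1 d' δE (1 - α) * (((ℓ + 1 : ℕ) : ℝ)) ^ 4) := by
    have := c1_nonneg d' δE (1 - α)
    positivity
  obtain ⟨aJ, haJ, HW⟩ := exists_junction_size 2 (S := (M₂ * ∑ j, ‖b j‖)) (A := (M₂ * (∑ j, ‖b j‖) * KG)) (A₁ := (M₂ * (∑ j, ‖b j‖) * KG)) (A₂ := (M₂ * (∑ j, ‖b j‖) * KG)) (KT := KT) (cg := (B6.c1 dg δ₀ αg)) (cb := (B6.c1 db δb βb))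
    (c1a := (B6.c1 d₁ ((1 - αst) * δ) α')) (c2a := (B6.c1 d₂ ((1 - αst) * δ₁) α')) (c3 := (B6.c1 d₃ ((1 - αst) * δ₂) α')) (c4 := (B6.c1 d₄ δ₃ αC)) (c5 := (B6.c1 d₅ δ₅ β₅)) (cB := (B6.c1 dB δB βB)) (cW := (B6.c1 dW δW₂ αW₂)) (B0 := (BE * B6.c1 d' δE (1 - α) * (((ℓ + 1 : ℕ) : ℝ)) ^ 4))
    hS hA hA hA hK (c1_nonneg _ _ _) (c1_nonneg _ _ _) (c1_nonneg _ _ _) (c1_nonneg _ _ _) (c1_nonneg _ _ _) (c1_nonneg _ _ _) (c1_nonneg _ _ _) hB0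
  refine ⟨aJ, haJ, fun aT haT haTQ haT3 haT2 hεB α₀' hα₀ hα₀le hα₀3 hα₀2 hslack => ?_⟩
  obtain ⟨h1, h2, h3⟩ := HW α₀' hα₀.le hα₀le
  obtain ⟨w1, w2, w3⟩ := junction_windows_of_small 2 (S := (M₂ * ∑ j, ‖b j‖)) (A := (M₂ * (∑ j, ‖b j‖) * KG)) (A₁ := (M₂ * (∑ j, ‖b j‖) * KG)) (A₂ := (M₂ * (∑ j, ‖b j‖) * KG)) (KT := KT) (cg := (B6.c1 dg δ₀ αg)) (cb := (B6.c1 db δb βb))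
    (c1a := (B6.c1 d₁ ((1 - αst) * δ) α')) (c2a := (B6.c1 d₂ ((1 - αst) * δ₁) α')) (c3 := (B6.c1 d₃ ((1 - αst) * δ₂) α')) (c4 := (B6.c1 d₄ δ₃ αC)) (c5 := (B6.c1 d₅ δ₅ β₅)) (cB := (B6.c1 dB δB βB)) (cW := (B6.c1 dW δW₂ αW₂)) (B0 := (BE * B6.c1 d' δE (1 - α) * (((ℓ + 1 : ℕ) : ℝ)) ^ 4))
    hα₀.le hS hA hA hA hK (c1_nonneg _ _ _) (c1_nonneg _ _ _) (c1_nonneg _ _ _) (c1_nonneg _ _ _) (c1_nonneg _ _ _) (c1_nonneg _ _ _) (c1_nonneg _ _ _)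
    hB0 rfl rfl rfl rfl rfl rfl rfl rfl rfl rfl rfl rfl rfl h1 h2 h3
  exact H a' ha' BE hBE aT haT haTQ haT3 haT2 hεB hα₀ hα₀3 hα₀2 hslack hKG hK rfl rfl rfl rfl rfl w1 rfl w2 rfl rfl rfl rfl rfl rfl rfl rfl rfl rfl w3

/-! ## §3  (v1.1) The rate ladder internalised: the suppliers' rate `δ₀ > 0` is the only rate displayed -/

/-- **THE RATE LADDER BELOW A GIVEN RATE**: for every `δ₀ > 0` the junction's twenty-three further rates ∕ fractions with ALL displayed conditions (signs, positive
products, `α ≤ 1`'s, the ladder equations, the three Lemma-2.1 budgets, 2b §3's split) EXIST — 5-bis's rational witness scaled by `δ₀` (fractions `½`; rates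
`δ₀∕2, δ₀∕8, δ₀∕32, δ₀∕128, δ₀∕1024, δ₀∕4096, δ₀∕8192`). [cite: Balaban1984PropagatorsII, Lemma 2.1 (2.60)–(2.63) p.234 («a decay rate arbitrarily close»), bookkeeping] -/
theorem rateLadder_below {δ₀ : ℝ} (hδ₀ : 0 < δ₀) : ∃ αg δc δb αb βb δ δ₁ δ₂ δ₃ αst α' αC δ₅ α₅ β₅ δB αB βB ρ δW₁ αW₁ δW₂ αW₂ : ℝ,
      0 ≤ δ₀ ∧ αg ≤ 1 ∧ 0 < αg * δ₀ ∧ 0 ≤ (1 - αg) * δ₀ ∧ 0 ≤ δc ∧ 0 < αb * δb ∧ 0 < βb * δb ∧ 0 ≤ αb ∧ 0 ≤ βb ∧ 0 ≤ δb ∧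
      δc + (αb + βb) * δb ≤ (1 - αg) * δ₀ ∧ δ ≤ (1 - αg) * δ₀ ∧ δ₁ = (1 - α') * ((1 - αst) * δ) ∧ δ₂ = (1 - α') * ((1 - αst) * δ₁) ∧
      δ₃ = (1 - α') * ((1 - αst) * δ₂) ∧ 0 < αst * δ ∧ 0 < αst * δ₁ ∧ 0 < αst * δ₂ ∧ 0 ≤ α' ∧ α' ≤ 1 ∧ 0 ≤ (1 - αst) * δ ∧ 0 ≤ (1 - αst) * δ₁ ∧
      0 ≤ (1 - αst) * δ₂ ∧ 0 < α' * ((1 - αst) * δ) ∧ 0 < α' * ((1 - αst) * δ₁) ∧ 0 < α' * ((1 - αst) * δ₂) ∧ 0 ≤ δ₃ ∧ 0 ≤ αC ∧ αC ≤ 1 ∧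
      0 < αC * δ₃ ∧ 0 ≤ (1 - αC) * δ₃ ∧ 0 < α₅ * δ₅ ∧ 0 < β₅ * δ₅ ∧ 0 ≤ α₅ ∧ 0 ≤ β₅ ∧ 0 ≤ δ₅ ∧ δc + 2 * (α₅ + β₅) * δ₅ ≤ (1 - αC) * δ₃ ∧
      0 < αB * δB ∧ 0 < βB * δB ∧ 0 ≤ ρ ∧ 0 ≤ αB ∧ 0 ≤ βB ∧ 0 ≤ δB ∧ ρ + (2 * αB + βB) * δB ≤ δc ∧ 0 < αW₁ * δW₁ ∧ 0 < αW₂ * δW₂ ∧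
      αW₁ * δW₁ + αW₂ * δW₂ ≤ ρ := by
  refine ⟨1 / 2, δ₀ / 1024, δ₀ / 8, 1 / 2, 1 / 2, δ₀ / 2, δ₀ / 8, δ₀ / 32, δ₀ / 128, 1 / 2, 1 / 2, 1 / 2, δ₀ / 1024, 1 / 2, 1 / 2, δ₀ / 8192, 1 / 2, 1 / 2, δ₀ / 4096, δ₀ / 8192, 1 / 2, δ₀ / 8192, 1 / 2, ?_, ?_, ?_, ?_, ?_, ?_, ?_, ?_, ?_, ?_, ?_, ?_, ?_, ?_, ?_, ?_, ?_, ?_, ?_, ?_, ?_, ?_, ?_, ?_, ?_, ?_, ?_, ?_, ?_, ?_, ?_, ?_, ?_, ?_, ?_, ?_, ?_, ?_, ?_, ?_, ?_, ?_, ?_, ?_, ?_, ?_, ?_⟩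
  all_goals linarith

/-- ★★★★★ **THE TORUS THM 2 COVER INTERFACE OF RECORD — FINAL DISPLAYED FORM** (`d + 1 = 3`, `N = 2`): §2's `hThm2Cover_of_prop6_eBlockSymG_small` with the rate
ladder INTERNALISED (`rateLadder_below`).  DISPLAYED INPUTS, all of them: `4 ≤ ℓ`; the trace functional `τ = tr` with its cyclicity and a Cauchy–Schwarz constant
`C_τ`; `M ≥ 1`; M5.7's rate data `δ_E > 0`, `0 < α < 1`; the length datum `len`; a real basis `b` of `M₂(ℂ)` with coordinate bound `M₂`; the weight-letter
parameters `Rr, Hp, Hg`; the suppliers' rate `δ₀ > 0` and constants `K_G, K_T ≥ 0`.  CONCLUSION: `∃ d′ A₀, ∀ a′ ≥ A₀, ∀ B_E > 0, ∃ a_J > 0, ∀ a_T ⟨FILE 4 ∕ F7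
windows⟩, ∀ 0 < α₀′ ≤ a_J ⟨C₀α₀′ ≤ ⅓, 2α₀′ ≤ c₂′, a_T·L² < α₀′⟩, ∃ a₀′ > 0, ∃ k₀, ∃ c_α > 0, ∀ c_L …, ∃ B₁ B₂ c₁ > 0, ∀ F : T3Family, F.L = ℓ + 1 → ∀ n < K`,
[(1ₛ) `IsUnit Δ_a(bgY i U₀; parSymY)` ∧ (Eₛ) `EBlock (kernelFamilyBInv i B cfg (GAY i (parSymY i) (parBY i) (GpY i (parSymY i))) par) B_E δ_E U₁` ∧ (Gₛ) `EBlock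
(kernelFamilySInv i B cfg (GpY i (parSymY i)) (parSymY i)) K_G δ₀ U₁` ∧ (Cₛ) `∀ sections ιB, conj b((η²η²)⁻¹•X_S⁻¹(bgY i U₀)) ≺ K_T(ℓ⁴)⁻¹e^{−δ₀d}`, for every
shape-member `i` (`k = m′+1`, constant level `m′`, `M_h = L^{a′}`, `c_f = L^{m′+1}`, inside `PV 2 ℓ (F.m + k₀) K`) and every admissible `(α₀, U₀)`] → `P ∣ P′ ∧ L^{K−n} ∣ P ∧
Thm2TorusAt (ℓ+1) (K − n) P′ (eta F n K) 0 B₁ B₂ c₁ len SU(2) ⊤`.  HONEST SCOPE: the four member statements are DISPLAYED, supplied by nothing here (M5.7 ∕ M5.5 ∕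
M5.6 lineages produce them from per-cube (3.35) data above thresholds); `stub_PV3A` NOT discharged; no summit ∕ node statement proved; nothing continuum ∕ ℝ⁴ ∕
OS — the Yang–Mills mass gap is NOT proved by any of this.
[cite: Balaban1985RegularSpaces, Thm 2 p.83, (1.29) p.81, (1.33)–(1.39) pp.82–83, (1.7) p.77, (1.58)–(1.60) pp.86–87; Balaban1985Averaging, Prop. 2 p.26, (52)–(53) pp.26–27; Balaban1985BackgroundPropagators, p.408 l.30–34, Thm 3.1 (3.42) p.397, Thm 3.2 (3.48) p.398, (3.25)–(3.27) p.394–395, (3.49) p.399, Thm 3.3 p.399, Thm 3.9 p.413, (3.101) p.414, (3.106) p.414, Thm 3.11 p.416; Balaban1984PropagatorsII, (2.50)–(2.55) p.232, Lemma 2.1 (2.60)–(2.63) p.234, (2.66)–(2.67) p.234; Balaban1985UV3, (1)–(3) p.256] -/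
theorem hThm2Cover_of_prop6_eBlockSymG_final (hℓ : 4 ≤ ℓ)
    (τ : (Matrix (Fin 2) (Fin 2) ℂ) →ₗ[ℂ] ℂ) (hτ : ∀ a, τ a = Matrix.trace a) (hτt : ∀ a b, τ (a * b) = τ (b * a))
    {Cτ : ℝ} (hCτ : ∀ x y : (Matrix (Fin 2) (Fin 2) ℂ), |(τ (star x * y)).re| ≤ Cτ * ‖x‖ * ‖y‖)
    {M : ℝ} (hM1 : 1 ≤ M) {δE α : ℝ} (hδE : 0 < δE) (hαE0 : 0 < α) (hα1 : α < 1)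
    {len : LSite (2 + 1) → ℝ}
    {ι : Type} [Fintype ι] [DecidableEq ι] (b : Module.Basis ι ℝ (Matrix (Fin 2) (Fin 2) ℂ)) {M₂ : ℝ} (hM₂ : 0 ≤ M₂)
    (hrepr : ∀ (v : (Matrix (Fin 2) (Fin 2) ℂ)) (j : ι), |b.repr v j| ≤ M₂ * ‖v‖)
    (Rr : ℝ) (Hp Hg : Prop) {δ₀ : ℝ} (hδ₀ : 0 < δ₀) {KG KT : ℝ} (hKG : 0 ≤ KG) (hK : 0 ≤ KT) :
    letI : CStarAlgebra (Matrix (Fin 2) (Fin 2) ℂ) := {}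
    ∃ d' A₀ : ℕ, ∀ a' : ℕ, A₀ ≤ a' → ∀ BE : ℝ, 0 < BE → ∃ aJ : ℝ, 0 < aJ ∧
    ∀ aT : ℝ, 0 < aT → aT ≤ alphaQ (2 + 1) (ℓ + 1) / ((ℓ + 1 : ℕ) : ℝ) ^ 2 → C0 (2 + 1) * aT ≤ 1 / 3 → 2 * aT ≤ c2' (2 + 1) (ℓ + 1) →
      2 * ((48 * (((2 : ℕ) : ℝ) + 1) + 14 * ((2 : ℕ) : ℝ) * M + (32 * (((2 : ℕ) : ℝ) + 2) ^ 2 +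
        12 * (((2 : ℕ) : ℝ) + 1) ^ 2 * (13344 * (((2 : ℕ) : ℝ) + 1) * (((2 : ℕ) : ℝ) + 2) ^ 2 * (((2 : ℕ) : ℝ) + 5) * (((ℓ + 1 : ℕ) : ℝ)) ^ (2 + 4)) *
          (Cτ * betaTau τ))) * aT) * (2 * (BE * B6.c1 d' δE (1 - α) * (((ℓ + 1 : ℕ) : ℝ)) ^ 4)) ≤ 1 →
    ∀ α₀' : ℝ, 0 < α₀' → α₀' ≤ aJ → C0 (2 + 1) * α₀' ≤ 1 / 3 → 2 * α₀' ≤ c2' (2 + 1) (ℓ + 1) → aT * (((ℓ + 1 : ℕ) : ℝ)) ^ (2 * 1) < α₀' →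
    ∃ a₀' : ℝ, 0 < a₀' ∧ ∃ k₀ : ℕ, ∃ cα : ℝ, 0 < cα ∧
    ∀ cL : ℝ, 0 < cL → cL * (((ℓ + 1 : ℕ) : ℝ)) ^ 2 < a₀' →
      cL ≤ min (1 / 16) (min aT (min aT (1 / (2 * (2 * (2 * (BE * B6.c1 d' δE (1 - α) * (((ℓ + 1 : ℕ) : ℝ)) ^ 4))) * (14 * ((2 + 1 - 1 : ℕ) : ℝ)) * M + 1)))) →
      cL ≤ cα →
    ∃ B₁' B₂ c₁ : ℝ, 0 < B₁' ∧ 0 < B₂ ∧ 0 < c₁ ∧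
    ∀ F : T3Family, F.L = ℓ + 1 → ∀ (n K : ℕ), n < K →
      (∀ (i : KIdx 2 ℓ hd₃ hL 1 1) (m' : ℕ), 1 ≤ m' → m' ≤ K - n → i.k = m' + 1 → (∀ x, i.D.lev x = m') → i.Mh = (ℓ + 1) ^ a' →
        i.cf = (((ℓ + 1 : ℕ) : ℝ)) ^ (m' + 1) →
        (∀ ι : IBondY i, i.w ι = i.cf ^ 2 * (((((ℓ + 1 : ℕ) : ℝ)) ^ (ι.1.1 : ℕ)) ^ (2 + 1) * (1 / (((ℓ + 1 : ℕ) : ℝ)) ^ (ι.1.1 : ℕ)) ^ 2)) →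
        (PV 2 ℓ i.m i.K hd₃ hL).sitesPerDir 0 = (PV 2 ℓ (F.m + k₀) K hd₃ hL).sitesPerDir 0 →
        ∀ (α₀ : ℝ) (U₀ : LSite (2 + 1) → Fin (2 + 1) → (Matrix (Fin 2) (Fin 2) ℂ)ˣ),
        (∀ x κ, U₀ x κ ∈ B7Prop2Explicit.unitaryUnits (Matrix (Fin 2) (Fin 2) ℂ)) →
        IsPeriodic ((PV 2 ℓ (F.m + k₀) K hd₃ hL).sitesPerDir 0) U₀ → 0 < α₀ → α₀ ≤ aT →
        InAk (ℓ + 1) m' (eta F n K) α₀ (fun _ => (Set.univ : Set (LSite (2 + 1)))) U₀ →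
          IsUnit (deltaAY i (parSymY i) (parBY i) (GpY i (parSymY i)) (bgY i U₀)) ∧
          (∀ (B : B9.Backgrounds) (cfg : B.Cfg → CfgY (Matrix (Fin 2) (Fin 2) ℂ) i) (par : BondParY (Matrix (Fin 2) (Fin 2) ℂ) i) (U₁ : B.Cfg),
            cfg U₁ = bgY i U₀ →
            EBlock (kernelFamilyBInv i B cfg (GAY i (parSymY i) (parBY i) (GpY i (parSymY i))) par) BE δE U₁) ∧
          (∀ (B : B9.Backgrounds) (cfg : B.Cfg → CfgY (Matrix (Fin 2) (Fin 2) ℂ) i) (U₁ : B.Cfg), cfg U₁ = (bgY i U₀) →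
              EBlock (kernelFamilySInv i B cfg (GpY i (parSymY i)) (parSymY i)) KG δ₀ U₁) ∧
            (∀ ιB : BlkY i → IBondY i, (∀ s, β i.hN i.D i.hk (ιB s) = s) →
              HasMajorant (g := toB6 (geo9K i) 1 Hg) (fun q : BlkY i × ι => ιB q.1)
                (conj b ((etaS i ^ 2 * etaS i ^ 2)⁻¹ • (XinvY i (parSymY i) (GpY i (parSymY i)) (bgY i U₀)).restrictScalars ℝ))
                (fun a a' => KT * ((geo9K i).len a ^ 4)⁻¹ * Real.exp (-(δ₀ * (geo9K i).dist a a'))))) →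
      (((F.P K).sitesPerDir 0 : ℕ) : ℤ) ∣ (((PV 2 ℓ (F.m + k₀) K hd₃ hL).sitesPerDir 0 : ℕ) : ℤ) ∧
      (((ℓ + 1 : ℕ) : ℤ)) ^ (K - n) ∣ (((F.P K).sitesPerDir 0 : ℕ) : ℤ) ∧
      Thm2TorusAt (ℓ + 1) (K - n) ((((PV 2 ℓ (F.m + k₀) K hd₃ hL).sitesPerDir 0 : ℕ) : ℤ)) (eta F n K) 0 B₁' B₂ c₁ len
        (specialUnitaryUnits (Fin 2)) (fun _ => True) := by
  obtain ⟨αg, δc, δb, αb, βb, δ, δ₁, δ₂, δ₃, αst, α', αC, δ₅, α₅, β₅, δB, αB, βB, ρ, δW₁, αW₁, δW₂, αW₂, hδ₀, hαg1, pαg, hαδg, hδc, pαb, pβb, hαb, hβb, hδb, hrb, hδ, hδ₁, hδ₂, hδ₃, pαst, pαst₁, pαst₂, hα'0, hα'1, hδ', hδ'₂, hδ'₃, p₁, p₂, p₃, hδ₃0, hαC0, hαC1, pαC, hαδ₄, pα₅, pβ₅, hα₅, hβ₅, hδ₅, hr₅, pαB, pβB, hρ, hαB, hβB, hδB, hrB,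 pαW₁, pαW₂, hsplit⟩ := rateLadder_below hδ₀
  exact hThm2Cover_of_prop6_eBlockSymG_small (hd₃ := hd₃) (hL := hL) (len := len) hℓ τ hτ hτt hCτ hM1 hδE hαE0 hα1 b hM₂ hrepr Rr Hp Hg
    hδ₀ hαg1 pαg hαδg hδc pαb pβb hαb hβb hδb hrb hδ hδ₁ hδ₂ hδ₃ pαst pαst₁ pαst₂ hα'0 hα'1 hδ' hδ'₂ hδ'₃ p₁ p₂ p₃ hδ₃0 hαC0 hαC1 pαC hαδ₄ pα₅ pβ₅ hα₅ hβ₅ hδ₅ hr₅ pαB pβB hρ hαB hβB hδB hrB pαW₁ pαW₂ hsplit hKG hK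

end Cover

/-! ## §4  (v1.2) The displayed `a_T` ∕ `α₀′` windows are jointly inhabited -/

/-- **NON-VACUITY OF THE SIZE WINDOWS** of `hThm2Cover_of_prop6_eBlockSymG_final`: for every junction class size `a_J > 0` and every pair of reals `S, B`
(the ε-window's bracket and `2B₀`), there are `α₀′` and `a_T` with ALL displayed window conditions: `0 < a_T ≤ α_Q∕L²`, `C₀a_T ≤ ⅓`, `2a_T ≤ c₂′`,
`2(S·a_T)·B ≤ 1`, `0 < α₀′ ≤ a_J`, `C₀α₀′ ≤ ⅓`, `2α₀′ ≤ c₂′`, `a_T·L² < α₀′` (`α₀′ = min (a_J, 1∕(3C₀), c₂′∕2)`, `a_T = min (α₀′∕(2L²), α_Q∕L², 1∕(2(max(SB,0)+1)))`).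
[cite: Balaban1985Averaging, Prop. 2 p.26 («α₀ sufficiently small»); Balaban1985RegularSpaces, (1.7) p.77, Thm 2 p.83 («ε sufficiently small»), bookkeeping] -/
theorem exists_admissible_sizes (d : ℕ) {L : ℕ} (hL : 1 ≤ L) (S B : ℝ) {aJ : ℝ} (haJ : 0 < aJ) :
    ∃ α₀' aT : ℝ, 0 < aT ∧ aT ≤ B9Eq316AveragingTransposeZd.alphaQ d L / (L : ℝ) ^ 2 ∧ B7Prop2Explicit.C0 d * aT ≤ 1 / 3 ∧
      2 * aT ≤ B7Prop2Explicit.c2' d L ∧ 2 * (S * aT) * B ≤ 1 ∧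
      0 < α₀' ∧ α₀' ≤ aJ ∧ B7Prop2Explicit.C0 d * α₀' ≤ 1 / 3 ∧ 2 * α₀' ≤ B7Prop2Explicit.c2' d L ∧ aT * (L : ℝ) ^ (2 * 1) < α₀' := by
  have hC0 := B7Prop2Explicit.C0_pos d
  have hc2 := B7Prop2Explicit.c2'_pos d L hL
  have hαQ := B9Eq316AveragingTransposeZd.alphaQ_pos d hL
  have hL1 : (1 : ℝ) ≤ (L : ℝ) := by exact_mod_cast hL
  have hLpos : (0 : ℝ) < (L : ℝ) := by linarith
  have hL2 : (1 : ℝ) ≤ (L : ℝ) ^ 2 := by nlinarith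
  obtain ⟨α, hαdef⟩ : ∃ α : ℝ, α = min aJ (min (1 / (3 * B7Prop2Explicit.C0 d)) (B7Prop2Explicit.c2' d L / 2)) := ⟨_, rfl⟩
  have hαpos : 0 < α := by rw [hαdef]; exact lt_min haJ (lt_min (by positivity) (by positivity))
  have hα1 : α ≤ aJ := by rw [hαdef]; exact min_le_left _ _
  have hα2 : α ≤ 1 / (3 * B7Prop2Explicit.C0 d) := by rw [hαdef]; exact (min_le_right _ _).trans (min_le_left _ _)
  have hα3 : α ≤ B7Prop2Explicit.c2' d L / 2 := by rw [hαdef]; exact (min_le_right _ _).trans (min_le_right _ _)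
  obtain ⟨Φ, hΦdef⟩ : ∃ Φ : ℝ, Φ = max (S * B) 0 := ⟨_, rfl⟩
  have hΦ0 : 0 ≤ Φ := by rw [hΦdef]; exact le_max_right _ _
  have hSB : S * B ≤ Φ := by rw [hΦdef]; exact le_max_left _ _
  obtain ⟨a, hadef⟩ : ∃ a : ℝ, a = min (α / (2 * (L : ℝ) ^ 2)) (min (B9Eq316AveragingTransposeZd.alphaQ d L / (L : ℝ) ^ 2) (1 / (2 * (Φ + 1)))) :=
    ⟨_, rfl⟩
  have hapos : 0 < a := by rw [hadef]; exact lt_min (by positivity) (lt_min (by positivity) (by positivity))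
  have ha1 : a ≤ α / (2 * (L : ℝ) ^ 2) := by rw [hadef]; exact min_le_left _ _
  have ha2 : a ≤ B9Eq316AveragingTransposeZd.alphaQ d L / (L : ℝ) ^ 2 := by rw [hadef]; exact (min_le_right _ _).trans (min_le_left _ _)
  have ha3 : a ≤ 1 / (2 * (Φ + 1)) := by rw [hadef]; exact (min_le_right _ _).trans (min_le_right _ _)
  have haL : a * (L : ℝ) ^ (2 * 1) ≤ α / 2 := by
    rw [show (2 * 1 : ℕ) = 2 from rfl]
    calc a * (L : ℝ) ^ 2 ≤ α / (2 * (L : ℝ) ^ 2) * (L : ℝ) ^ 2 := mul_le_mul_of_nonneg_right ha1 (by positivity)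
      _ = α / 2 := by field_simp
  have hL2' : (1 : ℝ) ≤ (L : ℝ) ^ (2 * 1) := by rw [show (2 * 1 : ℕ) = 2 from rfl]; exact hL2
  have haα : a ≤ α / 2 := (le_mul_of_one_le_right hapos.le hL2').trans haL
  refine ⟨α, a, hapos, ha2, ?_, ?_, ?_, hαpos, hα1, ?_, ?_, ?_⟩
  · have h : a ≤ 1 / (3 * B7Prop2Explicit.C0 d) := haα.trans ((half_le_self hαpos.le).trans hα2)
    calc B7Prop2Explicit.C0 d * a ≤ B7Prop2Explicit.C0 d * (1 / (3 * B7Prop2Explicit.C0 d)) := mul_le_mul_of_nonneg_left h hC0.le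
      _ = 1 / 3 := by field_simp
  · linarith [haα, hα3, hc2]
  · have h1 : a * Φ ≤ 1 / 2 := small_of_le hΦ0 ha3
    have h2 : a * (S * B) ≤ a * Φ := mul_le_mul_of_nonneg_left hSB hapos.le
    have h3 : 2 * (S * a) * B = 2 * (a * (S * B)) := by ring
    linarith [h1, h2, h3]
  · calc B7Prop2Explicit.C0 d * α ≤ B7Prop2Explicit.C0 d * (1 / (3 * B7Prop2Explicit.C0 d)) := mul_le_mul_of_nonneg_left hα2 hC0.le
      _ = 1 / 3 := by field_simp
  · linarith [hα3]
  · exact lt_of_le_of_lt haL (half_lt_self hαpos)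

end Literature.MathematicalPhysics.QuantumFieldTheory.Balaban1983to89.B8Thm2TorusCoverJunctionWindows

end
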